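import Summits.MatrixMultiplication.MatrixMultiplication.Theorems.SoloInformedSkewDoor

/-!
# The door is a family: carriers of Coppersmith–Winograd block shape

The laser-method value bound `ω ≤ log₂((4/27)·ρ³)` for `ρ > R̃(T)` (Coppersmith–Winograd 1990 §6 for
`T = T_{cw,2}`; Conner–Gesmundo–Landsberg–Ventura 2022 §2.2 for `T = T_{skewcw,2}`) uses only the
BLOCK SHAPE of the tensor: outer support `{(0,1,1),(1,0,1),(1,1,0)}` for the partition
`{0} ⊔ {1,2}` of each index set (a tight set), with every non-zero block a non-degenerate
`2 × 2` pairing, i.e. isomorphic to a matrix multiplication tensor `⟨1,1,2⟩`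
(Bürgisser–Clausen–Shokrollahi, *Algebraic Complexity Theory*, Thm. (15.41) with border rank
replaced by asymptotic rank, Ex. 15.24(7)). Every such tensor is, up to `GL₃ × GL₃ × GL₃`, one of the
**carriers** `T_{P,Q,M} = a₀ ⊗ P(b',c') + b₀ ⊗ Q(a',c') + c₀ ⊗ M(a',b')` defined below
(`cwShapeTensor P Q M`; only the entries of `P, Q, M` with both indices in `{1,2}` matter), and
normalising two of the blocks leaves `M ∈ GL₂(ℂ)` up to congruence `M ↦ λ·A M Aᵀ`.

This file records, sorry-free:

* the two members already in the kernel are instances: `T_{1,1,1} = T_{cw,2}`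
  (`cwShapeTensor_one_one_one`) and `T_{1,1,J} = T_{skewcw,2}` (`cwShapeTensor_one_one_skewBlock`);
* an abstract door lemma: ANY tensor `t` carrying the base-`2` value bound
  `∀ ρ > R̃(t), ω ≤ log₂(4ρ³/27)` with `R̃(t) ≤ 3` gives `ω = 2` (`matrixMultiplication_of_laserBound`),
  and the value bound is a theorem of the tree for `t = T_{cw,2}` and `t = T_{skewcw,2}`
  (`laserBound_cwTensor_two`, `laserBound_skewCwTensor_one`);
* the **family door, conditional form**: under the hypothesis that the value bound holds for every
  carrier with non-degenerate blocks (BCS Thm. (15.41) + Ex. 15.24(7), a published theorem not yet in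
  the Literature library — it is the only hypothesis), `R̃(T_{P,Q,M}) ≤ 3` for ONE non-degenerate
  triple `(P,Q,M)` implies `ω = 2` (`matrixMultiplication_of_cwShape_door`);
* the lower window for the whole family: `3 ≤ R̃(T_{P,Q,M})` as soon as the blocks `P` and `Q` are
  non-degenerate (`three_le_asymptoticRank_cwShapeTensor`, flattening rank `3`).

Informal context (not formalised): the carriers `T_{cw,2}` (`M` symmetric), `T_{skewcw,2}` (`M` skew)
and the generic `T_M` are pairwise non-isomorphic (orbit dimensions `23, 17, 23`; the degree-`9`
Koszul invariant vanishes exactly on the first) and pairwise not related by degeneration, so none of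
the doors `R̃(T_M) = 3 ⇒ ω = 2` is known to imply another.

[cite: BurgisserClausenShokrollahi1997, Thm. (15.41), Rem. (15.42), Ex. 15.24(7)]
[cite: CoppersmithWinograd1990, §6]
[cite: ConnerGesmundoLandsbergVentura2022, §2.2]
-/

namespace Summit.MatrixMultiplication.MatrixMultiplication.Theorems

open Literature.Computability.AlgebraicComplexity
open Literature.Barriers.MatrixMultiplication (flatteningRank_le_asymptoticRank)

namespace CarrierFamily

/-- The **carrier** of Coppersmith–Winograd block shape with blocks `P` (at `a₀`), `Q` (at `b₀`),
`M` (at `c₀`): `T i j k = P j k` if `i = 0, j, k ≠ 0`; `= Q i k` if `j = 0, i, k ≠ 0`; `= M i j` if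
`k = 0, i, j ≠ 0`; `= 0` otherwise. Row and column `0` of `P, Q, M` are ignored.
[cite: BurgisserClausenShokrollahi1997, (15.41)] -/
def cwShapeTensor (P Q M : Matrix (Fin 3) (Fin 3) ℂ) : Fin 3 → Fin 3 → Fin 3 → ℂ := fun i j k =>
  if i = 0 ∧ j ≠ 0 ∧ k ≠ 0 then P j k
  else if j = 0 ∧ i ≠ 0 ∧ k ≠ 0 then Q i k
  else if k = 0 ∧ i ≠ 0 ∧ j ≠ 0 then M i j
  else 0

/-- The skew `2 × 2` block `J` (as a `3 × 3` array): `J 1 2 = 1`, `J 2 1 = -1`. -/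
def skewBlock : Matrix (Fin 3) (Fin 3) ℂ := fun i j =>
  if i = 1 ∧ j = 2 then 1 else if i = 2 ∧ j = 1 then -1 else 0

/-- `T_{1,1,1} = T_{cw,2}`: the small Coppersmith–Winograd tensor is the carrier with three identity
blocks. [cite: CoppersmithWinograd1990, §6] -/
theorem cwShapeTensor_one_one_one : cwShapeTensor 1 1 1 = cwTensor ℂ 2 := by
  funext i j k
  fin_cases i <;> fin_cases j <;> fin_cases k <;>
    simp [cwShapeTensor, cwTensor]

/-- `T_{1,1,J} = T_{skewcw,2}`: the skew cousin is the carrier with blocks `1, 1, J`.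
[cite: ConnerGesmundoLandsbergVentura2022, eq. (3)] -/
theorem cwShapeTensor_one_one_skewBlock : cwShapeTensor 1 1 skewBlock = skewCwTensor ℂ 1 := by
  funext i j k
  fin_cases i <;> fin_cases j <;> fin_cases k <;>
    simp [cwShapeTensor, skewCwTensor, skewBlock]

/-! ## The abstract door -/

/-- **Abstract door, exponent form.** If a tensor `t` carries the base-`2` laser value bound
`R̃(t) < ρ ⇒ ω ≤ log₂(4ρ³/27)` and `R̃(t) ≤ 3`, then `ω ≤ 2` (take `ρ = 3·2^{η/3}`).
[cite: CoppersmithWinograd1990, §6] -/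
theorem omega_le_two_of_laserBound {ι : Type} [Fintype ι] [DecidableEq ι] {t : ι → ι → ι → ℂ}
    (hlaser : ∀ ρ : ℝ, asymptoticRank t < ρ → omega ℂ ≤ Real.logb 2 (4 * ρ ^ 3 / 27))
    (h : asymptoticRank t ≤ 3) : omega ℂ ≤ 2 := by
  refine le_of_forall_pos_le_add fun η hη => ?_
  have h2 : (1 : ℝ) < (2 : ℝ) ^ (η / 3) := Real.one_lt_rpow (by norm_num) (by positivity)
  have hρ3 : (3 : ℝ) < 3 * (2 : ℝ) ^ (η / 3) := by linarith
  have hA := hlaser _ (lt_of_le_of_lt h hρ3)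
  have hcube : (3 * (2 : ℝ) ^ (η / 3)) ^ 3 = 27 * (2 : ℝ) ^ η := by
    rw [mul_pow]
    have e : ((2 : ℝ) ^ (η / 3)) ^ 3 = (2 : ℝ) ^ η := by
      rw [← Real.rpow_natCast, ← Real.rpow_mul (by norm_num : (0 : ℝ) ≤ 2)]
      congr 1
      push_cast
      ring
    rw [e]
    norm_num
  have hval : Real.logb 2 (4 * (3 * (2 : ℝ) ^ (η / 3)) ^ 3 / 27) = 2 + η := by
    rw [hcube]
    have e : (4 : ℝ) * (27 * (2 : ℝ) ^ η) / 27 = (2 : ℝ) ^ ((2 : ℝ) + η) := by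
      rw [Real.rpow_add (by norm_num : (0 : ℝ) < 2), Real.rpow_two]
      ring
    rw [e, Real.logb_rpow (by norm_num) (by norm_num)]
  rw [hval] at hA
  exact hA

/-- **Abstract door.** A base-`2` laser value bound on `t` plus `R̃(t) ≤ 3` proves the summit
statement `ω(ℂ) = 2`. [cite: CoppersmithWinograd1990, §6] -/
theorem matrixMultiplication_of_laserBound {ι : Type} [Fintype ι] [DecidableEq ι]
    {t : ι → ι → ι → ℂ}
    (hlaser : ∀ ρ : ℝ, asymptoticRank t < ρ → omega ℂ ≤ Real.logb 2 (4 * ρ ^ 3 / 27))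
    (h : asymptoticRank t ≤ 3) : _root_.MatrixMultiplication :=
  _root_.MatrixMultiplication_iff.2
    (le_antisymm (omega_le_two_of_laserBound hlaser h) (omega_two_le ℂ))

/-- The value bound IS a theorem of the tree for the carrier `T_{1,1,1} = T_{cw,2}`.
[cite: CoppersmithWinograd1990, §6] -/
theorem laserBound_cwTensor_two (ρ : ℝ) (hρ : asymptoticRank (cwShapeTensor 1 1 1) < ρ) :
    omega ℂ ≤ Real.logb 2 (4 * ρ ^ 3 / 27) := by
  rw [cwShapeTensor_one_one_one] at hρ
  have h := omega_le_logb_of_asymptoticRank_cwTensor_lt (q := 2) le_rfl hρ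
  simpa using h

/-- The value bound IS a theorem of the tree for the carrier `T_{1,1,J} = T_{skewcw,2}`.
[cite: ConnerGesmundoLandsbergVentura2022, §2.2] -/
theorem laserBound_skewCwTensor_one (ρ : ℝ) (hρ : asymptoticRank (cwShapeTensor 1 1 skewBlock) < ρ) :
    omega ℂ ≤ Real.logb 2 (4 * ρ ^ 3 / 27) := by
  rw [cwShapeTensor_one_one_skewBlock] at hρ
  exact omega_le_logb_of_asymptoticRank_skewCwTensor_one_lt hρ

/-! ## The family door (conditional on BCS Thm. (15.41) for this block shape) -/

/-- The `{1,2} × {1,2}` block of a `3 × 3` array. -/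
def innerBlock (P : Matrix (Fin 3) (Fin 3) ℂ) : Matrix (Fin 2) (Fin 2) ℂ :=
  P.submatrix Fin.succ Fin.succ

/-- **The family door, conditional form.** Hypothesis `hBCS` is Bürgisser–Clausen–Shokrollahi
Thm. (15.41) (with `R̲` replaced by `R̃`, Ex. 15.24(7)) specialised to the Coppersmith–Winograd block
shape with the uniform distribution on the three support points: for every carrier with
non-degenerate blocks, `R̃(T_{P,Q,M}) < ρ ⇒ ω ≤ log₂(4ρ³/27)`. Under it, `R̃(T_{P,Q,M}) ≤ 3` for a
single non-degenerate triple already gives `ω(ℂ) = 2`. The hypothesis is discharged in the tree for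
`(1,1,1)` and `(1,1,J)` (`laserBound_cwTensor_two`, `laserBound_skewCwTensor_one`); for a general
triple it is a published theorem awaiting formalisation, NOT a conjecture.
[cite: BurgisserClausenShokrollahi1997, Thm. (15.41), Ex. 15.24(7)] -/
theorem matrixMultiplication_of_cwShape_door
    (hBCS : ∀ P Q M : Matrix (Fin 3) (Fin 3) ℂ, (innerBlock P).det ≠ 0 → (innerBlock Q).det ≠ 0 →
      (innerBlock M).det ≠ 0 → ∀ ρ : ℝ, asymptoticRank (cwShapeTensor P Q M) < ρ →
        omega ℂ ≤ Real.logb 2 (4 * ρ ^ 3 / 27))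
    {P Q M : Matrix (Fin 3) (Fin 3) ℂ} (hP : (innerBlock P).det ≠ 0) (hQ : (innerBlock Q).det ≠ 0)
    (hM : (innerBlock M).det ≠ 0) (h3 : asymptoticRank (cwShapeTensor P Q M) ≤ 3) :
    _root_.MatrixMultiplication :=
  matrixMultiplication_of_laserBound (hBCS P Q M hP hQ hM) h3

/-! ## The lower window for every carrier -/

/-- The `a`-slices of a carrier with non-degenerate blocks `P` (at `a₀`) and `Q` (at `b₀`) are
linearly independent: a vanishing combination `∑ gᵢ T(aᵢ,·,·) = 0` evaluated on row `b₀` gives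
`(g₁,g₂)·Q' = 0`, hence `g₁ = g₂ = 0`, and then `g₀ P' = 0` with `P' ≠ 0`. [folklore] -/
theorem linearIndependent_xSlices_cwShapeTensor {P Q M : Matrix (Fin 3) (Fin 3) ℂ}
    (hP : (innerBlock P).det ≠ 0) (hQ : (innerBlock Q).det ≠ 0) :
    LinearIndependent ℂ (xSlices (cwShapeTensor P Q M)) := by
  rw [Fintype.linearIndependent_iff]
  intro g hg
  have hev : ∀ b c : Fin 3, (∑ i, g i * cwShapeTensor P Q M i b c) = 0 := by
    intro b c
    have := congrFun hg (b, c)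
    simpa [Finset.sum_apply, Pi.smul_apply, xSlices_apply, smul_eq_mul] using this
  -- Step 1: `g₁ = g₂ = 0` from row `b₀` and the non-degeneracy of `Q'`.
  have hrow : ∀ c : Fin 2, g 1 * Q 1 c.succ + g 2 * Q 2 c.succ = 0 := by
    intro c
    have h := hev 0 c.succ
    rw [Fin.sum_univ_three] at h
    have hc : (c.succ : Fin 3) ≠ 0 := Fin.succ_ne_zero c
    simpa [cwShapeTensor, hc] using h
  have hvec : Matrix.vecMul ![g 1, g 2] (innerBlock Q) = 0 := by
    funext c
    simp only [Matrix.vecMul, dotProduct, Fin.sum_univ_two, innerBlock,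
      Matrix.submatrix_apply, Matrix.cons_val_zero, Matrix.cons_val_one, Pi.zero_apply]
    exact hrow c
  have hg12 := Matrix.eq_zero_of_vecMul_eq_zero hQ hvec
  have hg1 : g 1 = 0 := by simpa using congrFun hg12 0
  have hg2 : g 2 = 0 := by simpa using congrFun hg12 1
  -- Step 2: `g₀ = 0` from a non-zero entry of `P'`.
  have hg0 : g 0 = 0 := by
    by_contra h0
    apply hP
    have hPz : ∀ j k : Fin 2, P j.succ k.succ = 0 := by
      intro j k
      have h := hev j.succ k.succ
      rw [Fin.sum_univ_three] at h
      have hj : (j.succ : Fin 3) ≠ 0 := Fin.succ_ne_zero j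
      have hk : (k.succ : Fin 3) ≠ 0 := Fin.succ_ne_zero k
      simp [cwShapeTensor, hj, hk, hg1, hg2] at h
      rcases h with h | h
      · exact absurd h h0
      · exact h
    have h11 := hPz 0 0
    have h12 := hPz 0 1
    have h21 := hPz 1 0
    have h22 := hPz 1 1
    simp only [Fin.succ_zero_eq_one, Fin.succ_one_eq_two] at h11 h12 h21 h22
    rw [Matrix.det_fin_two]
    simp [innerBlock, h11, h12, h21, h22]
  intro i
  fin_cases i
  · exact hg0
  · exact hg1
  · exact hg2

/-- **Flattening rank `3` for every carrier with non-degenerate `P, Q`.** [folklore] -/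
theorem flatteningRank_cwShapeTensor {P Q M : Matrix (Fin 3) (Fin 3) ℂ}
    (hP : (innerBlock P).det ≠ 0) (hQ : (innerBlock Q).det ≠ 0) :
    flatteningRank (cwShapeTensor P Q M) = 3 := by
  unfold flatteningRank
  rw [finrank_span_eq_card (linearIndependent_xSlices_cwShapeTensor hP hQ), Fintype.card_fin]

/-- **Lower window for the family**: `3 ≤ R̃(T_{P,Q,M})` for all carriers with non-degenerate
`P, Q` (flattening rank is a lower bound for asymptotic rank). So every door of the family is the
single real inequality `R̃(T_{P,Q,M}) ≤ 3`, i.e. `R̃ = 3`.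
[cite: ChristandlVranaZuiddam2023, Example 1.4] -/
theorem three_le_asymptoticRank_cwShapeTensor {P Q M : Matrix (Fin 3) (Fin 3) ℂ}
    (hP : (innerBlock P).det ≠ 0) (hQ : (innerBlock Q).det ≠ 0) :
    (3 : ℝ) ≤ asymptoticRank (cwShapeTensor P Q M) := by
  have h := flatteningRank_le_asymptoticRank (cwShapeTensor P Q M)
  rw [flatteningRank_cwShapeTensor hP hQ] at h
  exact_mod_cast h

/-- **The family door decides the summit exactly at `3`**: under `hBCS`, for a non-degenerate
carrier, `R̃(T_{P,Q,M}) ≤ 3 ↔ R̃(T_{P,Q,M}) = 3`, and either gives `ω(ℂ) = 2`.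
[cite: BurgisserClausenShokrollahi1997, Thm. (15.41)] -/
theorem asymptoticRank_cwShapeTensor_le_three_iff_eq_three {P Q M : Matrix (Fin 3) (Fin 3) ℂ}
    (hP : (innerBlock P).det ≠ 0) (hQ : (innerBlock Q).det ≠ 0) :
    asymptoticRank (cwShapeTensor P Q M) ≤ 3 ↔ asymptoticRank (cwShapeTensor P Q M) = 3 :=
  ⟨fun h => le_antisymm h (three_le_asymptoticRank_cwShapeTensor hP hQ), fun h => h.le⟩

end CarrierFamily

end Summit.MatrixMultiplication.MatrixMultiplication.Theorems
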